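import Summits.NavierStokesRegularity.NavierStokesRegularity.Theses.TerminalTrace
import Summits.NavierStokesRegularity.NavierStokesRegularity.Theorems.TerminalTraceTraceDensityCriterionTypeI
import Summits.NavierStokesRegularity.NavierStokesRegularity.Theorems.TypeICertificateLadderNoTypeIBlowupTypeIMorrey
import Literature.Analysis.FluidPDE.SereginSverak2002FinalEnergy
import HarnessLib

/-!
# Crux `TerminalTrace.TraceDensityCriterion` (stmt-NavierStokesRegularity-18614), line `birth`: the TYPE-I-IN-TIME RUNGS of
# both registered stubs — `stub_traceForcesMorrey` (FE ⇒ Morrey bound at the vertex) and `stub_morrey_cell`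
# (= `MorreyCellCriterion`, stmt-NavierStokesRegularity-18615)

Seat nsreg-C26-p1 g6 (cell ns-regularity-ideate), `--supports stmt-NavierStokesRegularity-18614` (helper; closes nothing —
both stubs stay OPEN without the rate hypothesis).  The birth card of the crux (`Cruxes/TraceDensityCriterion/Lines/birth.md`)
names as «natural first rung» of its load-bearing stub `stub_traceForcesMorrey` the Type-I-in-time cell «`IsTypeIBlowup u T`
⇒ Morrey bound at the vertex» (Albritton–Barker 2019, Lemma 2.5 / Rem. 3.2); it is the tree's `morrey_of_typeI`
(route TypeICertificateLadder) read at one vertex: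

* `TerminalTrace.typeI_cknA_le` — frame (`ν, T > 0`, classical on `[0, T)`, Leray–Hopf on `[0, T]`) and `IsTypeIBlowup u T`
  ⇒ for every `x₀`: `∃ (M : ℝ≥0) r₀ > 0, ∀ r ∈ (0, r₀), cknA r (T, x₀) u ≤ M` — VERBATIM the conclusion of
  `stub_traceForcesMorrey` (whose FE hypothesis is not even needed in this cell);
* `TerminalTrace.typeI_morreyCellCriterion` — the statement of `MorreyCellCriterion` (18615) with the extra hypothesis
  `IsTypeIBlowup u T`: immediate from the landed Type-I cell of the crux (`TerminalTrace.typeI_traceDensityCriterion`,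
  p652624), the Morrey hypothesis unused.

So, restricted to Type-I-in-time first singularities, BOTH stubs of line `birth` and the crux are theorems; the open content
of 18614/18615 is entirely in the non-Type-I-in-time cell (`TerminalTrace.traceDensityCriterion_iff_notTypeI_cell`, p653295).
WHAT THIS IS NOT: not NS regularity, not 18614, not 18615.  [cite: AlbrittonBarker2019, Lemma 2.5] [folklore]
-/

set_option linter.dupNamespace false

noncomputable section

open MeasureTheory Set Function Filter Topology Metric
open scoped NNReal ENNReal
open Literature.Analysis.FluidPDE

namespace Summit.NavierStokesRegularity.NavierStokesRegularity.Theorems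

/-- **Type-I in time ⇒ Type I in the Albritton–Barker scaled-energy sense at every vertex of the final slice** (the
Type-I-in-time rung of `stub_traceForcesMorrey` of line `birth`, crux stmt-NavierStokesRegularity-18614): for a classical
Leray–Hopf solution on `[0, T)` with `‖u(t)‖_∞ ≤ C (T − t)^{-1/2}` near `T`, the scaled kinetic energy
`cknA r (T, x₀) u = sup_{t ∈ (T − r², T)} r⁻¹ ∫_{B(x₀,r)} ‖u(t)‖²` is bounded for all small `r`, at every `x₀`.
Proof: the tree's Morrey bound `morrey_of_typeI` (`∫_{B(x₁,ρ)} ‖u(t)‖² ≤ M₀ ρ` for `t ∈ (T₁, T)`, `ρ ≤ r₀`, every centre),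
read at `x₁ = x₀` for radii with `r² < min (T − T₁) T`. [cite: AlbrittonBarker2019, Lemma 2.5] -/
theorem TerminalTrace.typeI_cknA_le {ν T : ℝ} (hν : 0 < ν) (hT : 0 < T)
    {u : ℝ → EuclideanSpace ℝ (Fin 3) → EuclideanSpace ℝ (Fin 3)} {p : ℝ → EuclideanSpace ℝ (Fin 3) → ℝ}
    (hcl : IsClassicalNSSolutionOn (Ico 0 T) ν 0 u p) (hLH : IsLerayHopfOn T ν 0 (u 0) u)
    (hI : IsTypeIBlowup u T) (x₀ : EuclideanSpace ℝ (Fin 3)) :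
    ∃ (M : ℝ≥0) (r₀ : ℝ), 0 < r₀ ∧ ∀ r : ℝ, 0 < r → r < r₀ → cknA r (T, x₀) u ≤ M := by
  obtain ⟨r₀, M₀, T₁, hr₀, hT₁, hMor⟩ := morrey_of_typeI hν hT hcl hLH hI
  -- radii with `r < r₀`, `r² < T − T₁` and `r² < T`
  set r₁ : ℝ := min r₀ (Real.sqrt (min (T - T₁) T)) with hr₁
  have hmpos : 0 < min (T - T₁) T := lt_min (by linarith) hT
  have hr₁pos : 0 < r₁ := lt_min hr₀ (Real.sqrt_pos.2 hmpos)
  refine ⟨M₀.toNNReal, r₁, hr₁pos, fun r hr hrr₁ => ?_⟩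
  have hrr₀ : r < r₀ := lt_of_lt_of_le hrr₁ (min_le_left _ _)
  have hr2 : r ^ 2 < min (T - T₁) T := by
    have h1 : r < Real.sqrt (min (T - T₁) T) := lt_of_lt_of_le hrr₁ (min_le_right _ _)
    have h2 : r ^ 2 < (Real.sqrt (min (T - T₁) T)) ^ 2 := by
      exact pow_lt_pow_left₀ h1 hr.le two_ne_zero
    rwa [Real.sq_sqrt hmpos.le] at h2
  have hr2a : r ^ 2 < T - T₁ := lt_of_lt_of_le hr2 (min_le_left _ _)
  have hr2b : r ^ 2 < T := lt_of_lt_of_le hr2 (min_le_right _ _)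
  unfold cknA
  refine iSup₂_le fun t ht => ?_
  simp only at ht
  have htI : t ∈ Ioo T₁ T := ⟨by linarith [ht.1], ht.2⟩
  have ht0T : t ∈ Icc 0 T := ⟨by linarith [ht.1], ht.2.le⟩
  have hb := hMor t htI x₀ r hr hrr₀.le
  have hM₀r : 0 ≤ M₀ * r := le_trans (integral_nonneg fun x => sq_nonneg _) hb
  rw [SereginSverak2002.lintegral_ball_enorm_sq_eq_ofReal (hLH.memLp t ht0T) x₀ r]
  calc (ENNReal.ofReal r)⁻¹ * ENNReal.ofReal (∫ x in ball x₀ r, ‖u t x‖ ^ 2)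
      ≤ (ENNReal.ofReal r)⁻¹ * ENNReal.ofReal (M₀ * r) := by gcongr
    _ = (ENNReal.ofReal r)⁻¹ * (ENNReal.ofReal M₀ * ENNReal.ofReal r) := by
        rw [ENNReal.ofReal_mul' hr.le]
    _ = ENNReal.ofReal M₀ := by
        have hr0 : ENNReal.ofReal r ≠ 0 := by rwa [ne_eq, ENNReal.ofReal_eq_zero, not_le]
        rw [mul_comm (ENNReal.ofReal M₀), ← mul_assoc, ENNReal.inv_mul_cancel hr0 ENNReal.ofReal_ne_top, one_mul]
    _ = ((M₀.toNNReal : ℝ≥0) : ℝ≥0∞) := rfl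

/-- **`MorreyCellCriterion` (stmt-NavierStokesRegularity-18615) in its Type-I-in-time cell**: the statement of the route item
with the extra hypothesis `IsTypeIBlowup u T` — immediate from the Type-I cell of the crux
(`TerminalTrace.typeI_traceDensityCriterion`), the Morrey hypothesis being unused there. [folklore] -/
theorem TerminalTrace.typeI_morreyCellCriterion :
    ∀ (ν T : ℝ), 0 < ν → 0 < T →
      ∀ (u : ℝ → EuclideanSpace ℝ (Fin 3) → EuclideanSpace ℝ (Fin 3)) (p : ℝ → EuclideanSpace ℝ (Fin 3) → ℝ),
      IsClassicalNSSolutionOn (Ico 0 T) ν 0 u p → IsLerayHopfOn T ν 0 (u 0) u →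
      HasRapidSpatialDecay (u 0) → IsTypeIBlowup u T → ∀ x₀ : EuclideanSpace ℝ (Fin 3),
      (∃ (M : ℝ≥0) (r₀ : ℝ), 0 < r₀ ∧ ∀ r : ℝ, 0 < r → r < r₀ → cknA r (T, x₀) u ≤ M) →
      Tendsto (fun r : ℝ => r⁻¹ * ∫ x in ball x₀ r, ‖u T x‖ ^ 2) (𝓝[>] 0) (𝓝 0) →
      ∃ r > 0, ∃ C : ℝ, ∀ t ∈ Ioo (T - r ^ 2) T, ∀ x ∈ ball x₀ r, ‖u t x‖ ≤ C :=
  fun ν T hν hT u p hcl hLH hdec hI x₀ _ hFE =>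
    TerminalTrace.typeI_traceDensityCriterion ν T hν hT u p hcl hLH hdec hI x₀ hFE

end Summit.NavierStokesRegularity.NavierStokesRegularity.Theorems

end
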